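import Summits.QuantumFields.YangMills.Theorems.FluctuationComparisonRegPrIntLHeightwisePersistenceOfBounds5
import Literature.MathematicalPhysics.QuantumFieldTheory.Balaban1983to89.T3ThresholdSmallness
import HarnessLib

/-!
# `FluctuationComparisonRegPrIntLHeightwisePersistencePrintLiteral` — PERS₁∘ `OneLevelPersistenceIntCan` FROM [Balaban1985UV3] THEOREM 1 (5) READ LITERALLY (the lower half in the
# CONSTRAINED-MINIMISER currency, on print's own γ-scaled window (7)) + [Balaban1985Variational] THEOREM 1 (the tree's typed schema `Thm1GlobalMin`); and TUBE∘ on print's window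
# (crux `UnitScaleTilt.FluctuationComparisonRegPrIntL`, stmt-QuantumFields-20520; LINE g22-2∕g22-4 row PERS₁∘, g22-4∕g22-6 row TUBE∘; sibling of ✓`…HeightwisePersistenceOfBounds5`)

Cell `ym3-torus` (YM ladder rung R3 = continuum SU(2) Yang–Mills on T³ — a RUNG, NOT the Clay problem: not d = 4, not infinite volume, not a mass gap);
width seat `ym-ust-20520-w5` (gen 17); helper `--supports stmt-QuantumFields-20520`.  THEOREMS ONLY (0 `def`, 0 `sorry`, default heartbeats).

WHY.  ✓`…HeightwisePersistenceOfBounds5` §6 pins PERS₁∘ to Theorem 1 (5) both halves on PRINT'S window `{PlaqSmall θBal_n(b₀)}` (p.257 «ε₁ = g₀p(g₀)», step k `g_kp(g_k)`;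
`g_{K−n}p(g_{K−n}) = θBal F.L γ b₀ p₀ n`) with the lower half FOLDED to a constant `c_n`.  Print's lower half is LITERALLY `χ(U)·exp[−(1∕g_k²)A^η(U_k(U)) − O(1)|T₁^{(k)}|] ≤ ρ_k(U)`
with `U_k(U)` the constrained minimiser of [7]; folding it needs the K-UNIFORM regularity `β_K·minAction_{n,K}(V) ≤ A₀` on the window, which ✓§2 `regularityLetter_of_thm1GlobalMinAt` derives
from the tree's typed [7] schema at a FIXED `ε₁`.  THIS FILE runs it AT PRINT'S WINDOW (`ε₁ := θBal_n(b₀) ≤ min a₁ (a₀∕B₃)` once `γ ≤ γ₁(a₀,a₁,B₃,b₀,p₀)`, lit ✓`exists_forall_θBal_le` — a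
legitimate γ-smallness since [7]'s `a₀, a₁, B₃` «depend on d and L only»):
* §1 ★★`regularityLetter_on_balabanWindow` — `Thm1GlobalMin L` ⟹ `∃ γ₁ > 0, ∀ F γ n K (n < K) V, PlaqSmall θBal_n(b₀) V → β_K·minAction_{n,K}(V) ≤ 12(B₃θBal_n(b₀))²L^{3m+4n}∕γ`
  (= `12B₃²p(g_n)²L^{3(m+n)}` = print's «O(1) → ∞ as g → 0», K-FREE);
* §2 ★★`bounds5LowerOnWindow_of_literal_thm1` — print's LITERAL lower (5) on its window + §1 ⟹ the folded lower letter on the same window (diagonal `K = n` by lit ✓`minAction_self`);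
* §3 ★★★★`oneLevelPersistenceIntCan_of_bounds5Literal_thm1` — **PERS₁∘ VERBATIM ⟸ {Thm 1 (5) UPPER (`Bounds5UpperAtHeight`), Thm 1 (5) LOWER LITERAL on print's window, [7] Thm 1 (`Thm1GlobalMin`)}
  — AND NOTHING ELSE** (through ✓`oneLevelPersistenceIntCan_of_bounds5TwoSided_balabanWindow`);
* §4 ★★`sectionTubeMassIntCan_of_bounds5TwoSided_balabanWindow_haarTube` — TUBE∘ VERBATIM from (5) both halves with the lower letter at PROFILE `2·b₀` (TUBE∘'s ⟨LOW(2θ)⟩ set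
  `{PlaqSmall 2θ_{J+1}(b₀)}` IS print's window at `2b₀`, lit ✓`θBal_mul`; print's `b₀` is «a sufficiently large absolute constant», any larger profile is admissible) + ⟨HAAR-TUBE₁⟩.
* §5 (v1.1) ★★`regularityLetterRegPr_of_thm1GlobalMinAt` + ★★★★`oneLevelPersistenceIntCan_of_bounds5LiteralRegPr_thm1` — the same with PRINT'S OWN quantity `A^η(U_k(U))` = lit `minActionRegPr … a₀`
  (§1–§3 use the full-fibre `minAction ≤ minActionRegPr`, print-PLUS by the global-reading gap G-K1aR-2; §5 is the honest literal edition).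
HONEST SCOPE.  Doors; the hypotheses are print's Theorem 1 (5) halves for Bałaban's run objects (the cell's construction statement for `ℰp`), the typed [7] schema, the Haar tube letter;
nothing of Bałaban's is proved; PERS₁∘∕TUBE∘∕POS∘∕LFR♯ᶜ∘∕S2β∕20520∕`YM3TorusSU2` NOT proved; the Yang–Mills mass gap is NOT proved.
HYP-SAT (cell RULING №42).  Windows are print's γ-scaled `θBal … n` (class (1)); `E, O1_n` after `F, γ, n`, before `K`; `Thm1GlobalMin L` is the EX display's [7] schema.
References: [Balaban1985UV3] (1)–(7) pp.256–257, Thm 1 p.257, (47) p.267; [Balaban1985Variational] Thm 1 p.279, Prop 7 p.299; [Balaban1985Averaging] Prop. 1 p.22.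
-/

noncomputable section

set_option autoImplicit false

open MeasureTheory Filter Topology Set
open scoped ENNReal
open Literature.MathematicalPhysics.QuantumFieldTheory.Balaban1983to89
open Literature.MathematicalPhysics.QuantumFieldTheory.Balaban1983to89.T3ContinuumYM3Torus
open Literature.MathematicalPhysics.QuantumFieldTheory.Balaban1983to89.T3UnitLawDensityEML
open Literature.MathematicalPhysics.QuantumFieldTheory.Balaban1983to89.T3UnitScaleTilt
open Literature.MathematicalPhysics.QuantumFieldTheory.Balaban1983to89.T3TiltDescent
open Literature.MathematicalPhysics.QuantumFieldTheory.Balaban1983to89.T3HeightwiseDensityBounds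
open Literature.MathematicalPhysics.QuantumFieldTheory.Balaban1983to89.T3ConstrainedMinimiser
open Literature.MathematicalPhysics.QuantumFieldTheory.Balaban1983to89.T3PrintedMinimiserExistence
open Literature.MathematicalPhysics.QuantumFieldTheory.Balaban1983to89.T3RegularMinimiser
open Literature.MathematicalPhysics.QuantumFieldTheory.Balaban1983to89.T3PrintedRegularMinimiser
open Literature.MathematicalPhysics.QuantumFieldTheory.Balaban1983to89.T3ThresholdSmallness
open Literature.MathematicalPhysics.QuantumFieldTheory.Balaban1983to89.Missing
open Summit.QuantumFields.YangMills.Theorems.FluctuationComparisonRegPrIntLHeightwiseQuotientOfBounds5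
open Summit.QuantumFields.YangMills.Theorems.FluctuationComparisonRegPrIntLPersistenceFromHeightwiseBounds
open Summit.QuantumFields.YangMills.Theorems.FluctuationComparisonRegPrIntLPersistenceKFree
open Summit.QuantumFields.YangMills.Theorems.FluctuationComparisonRegPrIntLHeightwisePersistenceOfBounds5

namespace Summit.QuantumFields.YangMills.Theorems.FluctuationComparisonRegPrIntLHeightwisePersistencePrintLiteral

/-! ## §1 The regularity letter on print's γ-scaled window -/

/-- ★★ **THE K-UNIFORM REGULARITY LETTER ON PRINT'S WINDOW**: under the tree's typed [Balaban1985Variational] Thm 1 + Prop 7 schema `Thm1GlobalMin L` (constants `a₀, a₁, B₃` of `d, L`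
only), for every profile `(b₀, p₀)` there is `γ₁ > 0` such that for every member `F` (`F.L = L`), `0 < γ ≤ γ₁`, heights `n < K` and every datum `V` in print's window `|V(∂p) − 1| < θBal_n(b₀)`:
`β_K·minAction_{n,K}(V) ≤ 12(B₃θBal_n(b₀))²L^{3m+4n}∕γ` — INDEPENDENT OF `K` (at `θBal_n = g_np(g_n)`: `= 12B₃²p(g_n)²L^{3(m+n)}`, print's «O(1) goes to ∞ as g → 0»).  `γ₁` makes
`θBal_n(b₀) ≤ min a₁ (a₀∕B₃)` at every height (lit ✓`exists_forall_θBal_le`), so ✓`regularityLetter_of_thm1GlobalMinAt` applies with `ε₁ := θBal_n(b₀)`, `ε₀ := B₃θBal_n(b₀)`.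
[cite: Balaban1985Variational, Thm 1 p.279 and Prop 7 p.299; Balaban1985UV3, (5) p.256 and (7) p.257] -/
theorem regularityLetter_on_balabanWindow {L : ℕ} (hL : 1 ≤ L) (hT : Thm1GlobalMin L) (b₀ p₀ : ℝ) (hb₀ : 0 < b₀) :
    ∃ B₃ γ₁ : ℝ, 0 ≤ B₃ ∧ 0 < γ₁ ∧ γ₁ ≤ 1 ∧ ∀ (F : T3Family) (γ : ℝ), F.L = L → 0 < γ → γ ≤ γ₁ → ∀ (n K : ℕ) (hnK : n < K),
      ∀ V : GaugeField (F.P n) 0 (Matrix.specialUnitaryGroup (Fin 2) ℂ), PlaqSmall (θBal F.L γ b₀ p₀ n) V →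
        (F.scheme ℰp γ).β K * minAction F ℰp n K hnK.le V ≤ 12 * (B₃ * θBal F.L γ b₀ p₀ n) ^ 2 / γ * (F.L : ℝ) ^ (3 * F.m + 4 * n) := by
  obtain ⟨a₀, a₁, B₃, ha₀, ha₁, hB₃, _, hT⟩ := hT
  have hσ : 0 < min a₁ (a₀ / B₃) := lt_min ha₁ (div_pos ha₀ hB₃)
  obtain ⟨γ₁, hγ₁, hθ⟩ := exists_forall_θBal_le hL b₀ p₀ hσ
  refine ⟨B₃, min γ₁ 1, hB₃.le, lt_min hγ₁ one_pos, min_le_right _ _, fun F γ hF hγ hγle n K hnK V hV => ?_⟩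
  have hγ₁' : γ ≤ γ₁ := hγle.trans (min_le_left _ _)
  have hγ1 : γ ≤ 1 := hγle.trans (min_le_right _ _)
  have hFL : 1 ≤ F.L := F.hL.2.le
  have hε₁ : 0 < θBal F.L γ b₀ p₀ n := T3MinimiserStabilityReduction.θBal_pos hFL hγ hγ1 hb₀ p₀ n
  have hθle : θBal F.L γ b₀ p₀ n ≤ min a₁ (a₀ / B₃) := by rw [hF]; exact hθ γ hγ hγ₁' n
  have hε₁a : θBal F.L γ b₀ p₀ n ≤ a₁ := hθle.trans (min_le_left _ _)
  have hhi : B₃ * θBal F.L γ b₀ p₀ n ≤ a₀ := by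
    have h := mul_le_mul_of_nonneg_left (hθle.trans (min_le_right _ _)) hB₃.le
    rwa [mul_div_cancel₀ _ hB₃.ne'] at h
  exact regularityLetter_of_thm1GlobalMinAt hT hF hγ hnK hε₁ hε₁a hB₃.le le_rfl hhi V hV

/-! ## §2 Print's literal lower (5) on its window + [7] Thm 1 ⟹ the folded lower letter on the same window -/

/-- ★★ **FOLDING PRINT'S LITERAL LOWER HALF ON ITS OWN WINDOW.**  For a member `F` and coupling `γ` inside §1's `γ₁`: if at every height `n` the lower half of (5) holds LITERALLY —
`PlaqSmall θBal_n(b₀) V → exp(−β_K·minAction_{n,K}(V) − O1_n·|T₁^{(K−n)}|) ≤ e^{−E_K}ρ_{K−n}(V)` a.e., every run `K ≥ n` — then the folded letter `c_n ≤ e^{−E_K}ρ_{K−n}` holds a.e. on the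
same window with `c_n := exp(−max(12(B₃θBal_n)²L^{3m+4n}∕γ, β_n·12θBal_n²L^{3(m+n)}) − O1_n|T₁|)` (`K > n` by §1's letter `hreg`, `K = n` by lit ✓`minAction_self`).
[cite: Balaban1985UV3, (5) p.256, (7) p.257 and (47) p.267; Balaban1985Variational, Thm 1 p.279] -/
theorem bounds5LowerOnWindow_of_literal {F : T3Family} {γ : ℝ} (hγ : 0 < γ) (hγ1 : γ ≤ 1) {b₀ p₀ B₃ : ℝ} (hb₀ : 0 < b₀) {E : ℕ → ℝ}
    (hreg : ∀ (n K : ℕ) (hnK : n < K), ∀ V : GaugeField (F.P n) 0 (Matrix.specialUnitaryGroup (Fin 2) ℂ), PlaqSmall (θBal F.L γ b₀ p₀ n) V →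
      (F.scheme ℰp γ).β K * minAction F ℰp n K hnK.le V ≤ 12 * (B₃ * θBal F.L γ b₀ p₀ n) ^ 2 / γ * (F.L : ℝ) ^ (3 * F.m + 4 * n))
    (h : ∀ n : ℕ, ∃ O1 : ℝ, ∀ (K : ℕ) (hK : n ≤ K),
      ∀ᵐ V ∂(fieldMeasure (F.P n) 0 (Matrix.specialUnitaryGroup (Fin 2) ℂ)), PlaqSmall (θBal F.L γ b₀ p₀ n) V →
        Real.exp (-((F.scheme ℰp γ).β K * minAction F ℰp n K hK V) - O1 * ((F.P n).sitesPerDir 0 : ℝ) ^ 3) ≤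
          Real.exp (-E K) * heightDensity F γ hK Set.univ V) :
    ∀ n : ℕ, ∃ c : ℝ, 0 < c ∧ ∀ (K : ℕ) (hK : n ≤ K),
      ∀ᵐ V ∂(fieldMeasure (F.P n) 0 (Matrix.specialUnitaryGroup (Fin 2) ℂ)), PlaqSmall (θBal F.L γ b₀ p₀ n) V →
        c ≤ Real.exp (-E K) * heightDensity F γ hK Set.univ V := by
  intro n
  obtain ⟨O1, hO1⟩ := h n
  have hFL : 1 ≤ F.L := F.hL.2.le
  have hθ0 : 0 ≤ θBal F.L γ b₀ p₀ n := (T3MinimiserStabilityReduction.θBal_pos hFL hγ hγ1 hb₀ p₀ n).le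
  set A₀ : ℝ := max (12 * (B₃ * θBal F.L γ b₀ p₀ n) ^ 2 / γ * (F.L : ℝ) ^ (3 * F.m + 4 * n))
    ((F.scheme ℰp γ).β n * (12 * θBal F.L γ b₀ p₀ n ^ 2 * (F.L : ℝ) ^ (3 * (F.m + n)))) with hA₀
  refine ⟨Real.exp (-A₀ - O1 * ((F.P n).sitesPerDir 0 : ℝ) ^ 3), Real.exp_pos _, fun K hK => ?_⟩
  have hregK : ∀ V : GaugeField (F.P n) 0 (Matrix.specialUnitaryGroup (Fin 2) ℂ), PlaqSmall (θBal F.L γ b₀ p₀ n) V →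
      (F.scheme ℰp γ).β K * minAction F ℰp n K hK V ≤ A₀ := by
    intro V hV
    rcases Nat.lt_or_ge n K with hlt | hge
    · exact (hreg n K hlt V hV).trans (le_max_left _ _)
    · obtain rfl : n = K := le_antisymm hK hge
      refine le_trans ?_ (le_max_right _ _)
      refine mul_le_mul_of_nonneg_left ?_ (F.scheme_β_nonneg ℰp hγ.le n)
      rw [T3DescentFibreTower.minAction_self F ℰp n V]
      exact wilsonAction4_le_of_plaqSmall_run F n hθ0 hV
  filter_upwards [hO1 K hK] with V hV hVs
  refine le_trans (Real.exp_le_exp.mpr ?_) (hV hVs)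
  have := hregK V hVs
  linarith

/-! ## §3 The print-literal capstone -/

/-- ★★★★ **PERS₁∘ `OneLevelPersistenceIntCan` VERBATIM ⟸ [Balaban1985UV3] THEOREM 1 (5) READ LITERALLY + [Balaban1985Variational] THEOREM 1 — AND NOTHING ELSE.**  Hypotheses: (a) the
tree's typed [7] schema `Thm1GlobalMin L` for every odd `L > 1` (the EX display's input); (b) in PERS₁∘'s prefix, after `F, γ`: a run normalisation `E` (print's (1)) with (5) UPPER at every
height (lit `Bounds5UpperAtHeight F γ E`) and (5) LOWER LITERALLY — `exp(−β_K·minAction_{n,K}(V) − O1_n·|T₁^{(K−n)}|) ≤ e^{−E_K}ρ_{K−n}(V)` a.e. on PRINT'S window `{PlaqSmall θBal_n(b₀)}` at every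
height `n ≤ K` (`β_K·minAction` = print's `(1∕g_k²)A^η(U_k(U))`, lit `T3ConstrainedMinimiser.minAction`).  Conclusion: PERS₁∘ byte for byte.  Inside: `γ₁` is cut to §1's `γ₁(a₀,a₁,B₃,b₀,p₀)`
and to `1`; §2 folds the literal lower half; ✓`oneLevelPersistenceIntCan_of_bounds5TwoSided_balabanWindow` (✓p766525) finishes.  SO THE PERSISTENCE ROW'S WHOLE DEBT IS PRINT'S TWO THEOREMS,
IN PRINT'S LETTERS.  HONEST SCOPE: a door; neither theorem is proved here; PERS₁∘∕POS∘∕LFR♯ᶜ∘∕S2β∕20520∕`YM3TorusSU2` NOT proved; the Yang–Mills mass gap is NOT proved.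
[cite: Balaban1985UV3, (1)-(7) pp.256-257, Thm 1 p.257, (47) p.267; Balaban1985Variational, Thm 1 p.279 and Prop 7 p.299] -/
theorem oneLevelPersistenceIntCan_of_bounds5Literal_thm1 (hT : ∀ L : ℕ, Odd L → 1 < L → Thm1GlobalMin L)
    (h : ∀ (L : ℕ), ∃ c₀ : ℝ, 0 < c₀ ∧ c₀ ≤ 1 ∧ ∀ (c : ℝ), 0 < c → c ≤ c₀ → ∃ pS : ℝ, ∀ (b₀ p₀ : ℝ), 0 < b₀ → pS ≤ p₀ → 0 < p₀ →
      ∃ γ₁ : ℝ, 0 < γ₁ ∧ ∀ (F : T3Family) (γ : ℝ), F.L = L → 0 < γ → γ ≤ γ₁ →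
        ∃ E : ℕ → ℝ, Bounds5UpperAtHeight F γ E ∧
          ∀ n : ℕ, ∃ O1 : ℝ, ∀ (K : ℕ) (hK : n ≤ K),
            ∀ᵐ V ∂(fieldMeasure (F.P n) 0 (Matrix.specialUnitaryGroup (Fin 2) ℂ)), PlaqSmall (θBal F.L γ b₀ p₀ n) V →
              Real.exp (-((F.scheme ℰp γ).β K * minAction F ℰp n K hK V) - O1 * ((F.P n).sitesPerDir 0 : ℝ) ^ 3) ≤
                Real.exp (-E K) * heightDensity F γ hK Set.univ V) :
    ∀ (L : ℕ), ∃ c₀ : ℝ, 0 < c₀ ∧ c₀ ≤ 1 ∧ ∀ (c : ℝ), 0 < c → c ≤ c₀ → ∃ pS : ℝ, ∀ (b₀ p₀ : ℝ), 0 < b₀ → pS ≤ p₀ → 0 < p₀ →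
      ∃ γ₁ : ℝ, 0 < γ₁ ∧ ∀ (F : T3Family) (γ : ℝ), F.L = L → 0 < γ → γ ≤ γ₁ →
        ∀ (J : ℕ), ∃ q : ℝ, 0 < q ∧ ∀ (K : ℕ) (hJK : J + 1 ≤ K)
          (B : Set (GaugeField (F.P J) 0 (Matrix.specialUnitaryGroup (Fin 2) ℂ))), MeasurableSet B →
            B ⊆ {U | PlaqSmall (θBal F.L γ (c * b₀) p₀ J) U} →
            ENNReal.ofReal q * gibbsK F ℰp γ K (descendTo F ℰp J K ((Nat.le_succ J).trans hJK) ⁻¹' B) ≤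
              gibbsK F ℰp γ K (descendTo F ℰp J K ((Nat.le_succ J).trans hJK) ⁻¹' B ∩
                descendTo F ℰp (J + 1) K hJK ⁻¹' {V | PlaqSmall (θBal F.L γ (c * b₀) p₀ (J + 1)) V}) := by
  refine oneLevelPersistenceIntCan_of_bounds5TwoSided_balabanWindow fun L => ?_
  obtain ⟨c₀, hc₀, hc₀1, hc⟩ := h L
  refine ⟨c₀, hc₀, hc₀1, fun c hcpos hcle => ?_⟩
  obtain ⟨pS, hpS⟩ := hc c hcpos hcle
  refine ⟨pS, fun b₀ p₀ hb₀ hpS' hp₀ => ?_⟩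
  obtain ⟨γ₁, hγ₁, hγ₁F⟩ := hpS b₀ p₀ hb₀ hpS' hp₀
  by_cases hLo : Odd L ∧ 1 < L
  · obtain ⟨B₃, γθ, hB₃, hγθ, hγθ1, hreg⟩ := regularityLetter_on_balabanWindow (le_of_lt hLo.2) (hT L hLo.1 hLo.2) b₀ p₀ hb₀
    refine ⟨min γ₁ γθ, lt_min hγ₁ hγθ, (min_le_right _ _).trans hγθ1, fun F γ hFL hγ hγle => ?_⟩
    obtain ⟨E, h5, hlit⟩ := hγ₁F F γ hFL hγ (hγle.trans (min_le_left _ _))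
    have hγθ' : γ ≤ γθ := hγle.trans (min_le_right _ _)
    exact ⟨E, h5, bounds5LowerOnWindow_of_literal hγ (hγθ'.trans hγθ1) hb₀ (hreg F γ hFL hγ hγθ') hlit⟩
  · -- no member of the family has an even or `≤ 1` block size
    refine ⟨min γ₁ 1, lt_min hγ₁ one_pos, min_le_right _ _, fun F γ hFL _ _ => ?_⟩
    exact absurd (hFL ▸ F.hL) hLo

/-! ## §4 TUBE∘ on print's window at profile `2·b₀` -/

/-- ★★ **TUBE∘ `SectionTubeMassIntCan` VERBATIM ⟸ THEOREM 1 (5), BOTH HALVES, ON PRINT'S WINDOW AT PROFILE `2·b₀`, + ⟨HAAR-TUBE₁⟩.**  TUBE∘'s ⟨LOW(2θ)⟩ (LEAD ✓`sectionTubeMassIntCan_of_up_low_haarTube`)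
sits on `{PlaqSmall 2θ_{J+1}(b₀)}`, which IS print's γ-scaled window at the profile `2b₀`: `θBal(2·b₀) = 2·θBal(b₀)` (lit ✓`T3InteriorExcision.θBal_mul`; print's `b₀` is «a sufficiently large
absolute constant», so the larger profile is print-admissible).  Hypothesis = TUBE∘'s prefix (`γ₁ ≤ 1`) with, after `F, γ`, `∃ E, Bounds5UpperAtHeight F γ E ∧ ∀ n, ∃ c_n > 0, ∀ K ≥ n, ∀ᵐ V,
PlaqSmall θBal_n(2b₀) V → c_n ≤ e^{−E_K}ρ_{K−n}(V)` and, per `J`, ⟨HAAR-TUBE₁⟩ verbatim ⟹ TUBE∘ byte for byte — no γ-shrinking.  HONEST SCOPE: a door; (5) NOT proved; TUBE∘∕PERS₁∘∕LFR♯ᶜ∘∕20520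
NOT proved. [cite: Balaban1985UV3, (4)-(7) pp.256-257, Thm 1 p.257; Balaban1985Averaging, Prop. 1 p.22] -/
theorem sectionTubeMassIntCan_of_bounds5TwoSided_balabanWindow_haarTube
    (h : ∀ (L : ℕ), ∃ c₀ : ℝ, 0 < c₀ ∧ c₀ ≤ 1 ∧ ∀ (c : ℝ), 0 < c → c ≤ c₀ → ∃ pS : ℝ, ∀ (b₀ p₀ : ℝ), 0 < b₀ → pS ≤ p₀ → 0 < p₀ →
      ∃ γ₁ : ℝ, 0 < γ₁ ∧ γ₁ ≤ 1 ∧ ∀ (F : T3Family) (γ : ℝ), F.L = L → 0 < γ → γ ≤ γ₁ →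
        (∃ E : ℕ → ℝ, Bounds5UpperAtHeight F γ E ∧
          ∀ n : ℕ, ∃ cn : ℝ, 0 < cn ∧ ∀ (K : ℕ) (hK : n ≤ K),
            ∀ᵐ V ∂(fieldMeasure (F.P n) 0 (Matrix.specialUnitaryGroup (Fin 2) ℂ)), PlaqSmall (θBal F.L γ (2 * b₀) p₀ n) V →
              cn ≤ Real.exp (-E K) * heightDensity F γ hK Set.univ V) ∧
        ∀ (J : ℕ) (r : ℝ), 0 < r →
            ∀ σ : GaugeField (F.P J) 0 (Matrix.specialUnitaryGroup (Fin 2) ℂ) → GaugeField (F.P (J + 1)) 0 (Matrix.specialUnitaryGroup (Fin 2) ℂ), Measurable σ →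
              (∀ U : GaugeField (F.P J) 0 (Matrix.specialUnitaryGroup (Fin 2) ℂ), PlaqSmall (θBal F.L γ (c * b₀) p₀ J) U →
                descendTo F ℰp J (J + 1) (Nat.le_succ J) (σ U) = U ∧ PlaqSmall (θBal F.L γ b₀ p₀ (J + 1)) (σ U)) →
              ∃ q' : ℝ, 0 < q' ∧ ∀ (B : Set (GaugeField (F.P J) 0 (Matrix.specialUnitaryGroup (Fin 2) ℂ))), MeasurableSet B →
                B ⊆ {U | PlaqSmall (θBal F.L γ (c * b₀) p₀ J) U} →
                ENNReal.ofReal q' * fieldMeasure (F.P (J + 1)) 0 (Matrix.specialUnitaryGroup (Fin 2) ℂ) (descendTo F ℰp J (J + 1) (Nat.le_succ J) ⁻¹' B) ≤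
                  fieldMeasure (F.P (J + 1)) 0 (Matrix.specialUnitaryGroup (Fin 2) ℂ) (descendTo F ℰp J (J + 1) (Nat.le_succ J) ⁻¹' B ∩
                    {V | ∀ b : PBond (F.P (J + 1)) 0, dist1 ((σ (descendTo F ℰp J (J + 1) (Nat.le_succ J) V) b)⁻¹ * V b) < r})) :
    ∀ (L : ℕ), ∃ c₀ : ℝ, 0 < c₀ ∧ c₀ ≤ 1 ∧ ∀ (c : ℝ), 0 < c → c ≤ c₀ → ∃ pS : ℝ, ∀ (b₀ p₀ : ℝ), 0 < b₀ → pS ≤ p₀ → 0 < p₀ →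
      ∃ γ₁ : ℝ, 0 < γ₁ ∧ ∀ (F : T3Family) (γ : ℝ), F.L = L → 0 < γ → γ ≤ γ₁ →
        ∀ (J : ℕ) (r : ℝ), 0 < r →
          ∀ σ : GaugeField (F.P J) 0 (Matrix.specialUnitaryGroup (Fin 2) ℂ) → GaugeField (F.P (J + 1)) 0 (Matrix.specialUnitaryGroup (Fin 2) ℂ), Measurable σ →
            (∀ U : GaugeField (F.P J) 0 (Matrix.specialUnitaryGroup (Fin 2) ℂ), PlaqSmall (θBal F.L γ (c * b₀) p₀ J) U →
              descendTo F ℰp J (J + 1) (Nat.le_succ J) (σ U) = U ∧ PlaqSmall (θBal F.L γ b₀ p₀ (J + 1)) (σ U)) →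
            ∃ q : ℝ, 0 < q ∧ ∀ (K : ℕ) (hJK : J + 1 ≤ K)
              (B : Set (GaugeField (F.P J) 0 (Matrix.specialUnitaryGroup (Fin 2) ℂ))), MeasurableSet B →
                B ⊆ {U | PlaqSmall (θBal F.L γ (c * b₀) p₀ J) U} →
                ENNReal.ofReal q * gibbsK F ℰp γ K (descendTo F ℰp J K ((Nat.le_succ J).trans hJK) ⁻¹' B) ≤
                  gibbsK F ℰp γ K (descendTo F ℰp J K ((Nat.le_succ J).trans hJK) ⁻¹' B ∩
                    {V | ∀ b : PBond (F.P (J + 1)) 0,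
                      dist1 ((σ (descendTo F ℰp J K ((Nat.le_succ J).trans hJK) V) b)⁻¹ *
                        descendTo F ℰp (J + 1) K hJK V b) < r}) := by
  refine Summit.QuantumFields.YangMills.Theorems.FluctuationComparisonRegPrIntLSectionTubeSplit.sectionTubeMassIntCan_of_up_low_haarTube fun L => ?_
  obtain ⟨c₀, hc₀, hc₀1, hc⟩ := h L
  refine ⟨c₀, hc₀, hc₀1, fun c hcpos hcle => ?_⟩
  obtain ⟨pS, hpS⟩ := hc c hcpos hcle
  refine ⟨pS, fun b₀ p₀ hb₀ hpS' hp₀ => ?_⟩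
  obtain ⟨γ₁, hγ₁, hγ₁1, hγ₁F⟩ := hpS b₀ p₀ hb₀ hpS' hp₀
  refine ⟨γ₁, hγ₁, hγ₁1, fun F γ hFL hγ hγle J => ?_⟩
  obtain ⟨⟨E, h5, h5low⟩, hHT⟩ := hγ₁F F γ hFL hγ hγle
  have hL1 : 1 ≤ F.L := F.hL.2.le
  have hγ1 : γ ≤ 1 := hγle.trans hγ₁1
  have h2b₀ : 0 < 2 * b₀ := by linarith
  -- TUBE∘'s `⟨LOW(2θ)⟩` set is print's window at profile `2b₀`
  have hθeq : ∀ i : ℕ, 2 * θBal F.L γ b₀ p₀ i = θBal F.L γ (2 * b₀) p₀ i := fun i => (T3InteriorExcision.θBal_mul F.L γ 2 b₀ p₀ i).symm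
  have hup : HeightwiseUpperBound F γ := by
    obtain ⟨c0, hc0, h0⟩ := h5low 0
    refine heightwiseUpperBound_of_bounds5TwoSided hγ.le h5 ⟨θBal F.L γ (2 * b₀) p₀ 0, c0, ?_, hc0, fun K => h0 K (Nat.zero_le K)⟩
    exact T3MinimiserStabilityReduction.θBal_pos hL1 hγ hγ1 h2b₀ p₀ 0
  obtain ⟨C, hC, hUP⟩ := up_of_heightwiseUpperBound F hγ.le hup J
  obtain ⟨⟨cJ, hcJ, hlowJ⟩, ⟨O1, hO1⟩⟩ := And.intro (h5low (J + 1)) (h5 (J + 1))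
  have hθpos := T3MinimiserStabilityReduction.θBal_pos hL1 hγ hγ1 h2b₀ p₀ (J + 1)
  haveI := isProbabilityMeasure_fieldMeasure (G := Matrix.specialUnitaryGroup (Fin 2) ℂ) (F.P (J + 1)) 0
  refine ⟨⟨C, cJ / Real.exp (O1 * ((F.P (J + 1)).sitesPerDir 0 : ℝ) ^ 3), hC, div_pos hcJ (Real.exp_pos _), fun K hJK => ⟨hUP K hJK _, ?_⟩⟩, hHT J⟩
  refine low_of_heightwiseLowerDensity F hγ.le hJK (measurableSet_plaqSmall _) ?_
  obtain ⟨hdm, hdi⟩ := heightDensity_props F hJK MeasurableSet.univ hγ.le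
  have hq := quotient_lower_ae (μ := fieldMeasure (F.P (J + 1)) 0 (Matrix.specialUnitaryGroup (Fin 2) ℂ)) hdi
    (heightDensity_nonneg F γ hJK Set.univ) (measurableSet_plaqSmall_window (F.P (J + 1)) 0 (θBal F.L γ (2 * b₀) p₀ (J + 1)))
    (measureReal_plaqSmall_pos (F.P (J + 1)) 0 hθpos) (Real.exp_pos (-E K)) hcJ (hO1 K hJK) (hlowJ K hJK)
  rw [integral_heightDensity_univ_eq_partitionFn F hγ.le hJK] at hq
  filter_upwards [hq] with V hV hVs
  exact hV (fun p => lt_of_lt_of_le (hVs p) (le_of_eq (hθeq (J + 1))))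


/-! ## §5 (v1.1) ERRATUM-IN-KIND: print's `A^η(U_k(U))` is the [7]-MINIMISER's action = lit `minActionRegPr … a₀`, NOT the full-fibre infimum `minAction` -/

/-- ★★ **THE REGULARITY LETTER FOR PRINT'S OWN QUANTITY `A^η(U_k(U))`.**  In (5) the exponent carries the action of the constrained minimiser `U_k(U)` «constructed in [7]» — the minimum
of the Wilson action over print's regular space (6) at radius `a₀`, i.e. lit `minActionRegPr F n K h a₀ V` — and NOT the infimum over the whole fibre (lit `minAction`, used in §1–§3; the two
agree only under the GLOBAL reading located as G-K1aR-2 ∕ lit `InfSixOfEightAt`; always `minAction ≤ minActionRegPr`, so §2–§3's hypothesis is print-PLUS by exactly that gap).  Under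
`Thm1GlobalMinAt L a₀ a₁ B₃`: for `F.L = L`, `γ > 0`, `n < K`, `0 < ε₁ ≤ a₁`, `0 ≤ B₃`, `B₃ε₁ ≤ a₀`, and `PlaqSmall ε₁ V`:
`β_K · minActionRegPr_{n,K}(a₀; V) ≤ 12(B₃ε₁)²L^{3m+4n}∕γ` — K-FREE (the schema's point lies in `regFibrePr (B₃ε₁) V ⊆ regFibrePr a₀ V`, lit ✓`regFibrePr_mono`, ✓`minActionRegPr_le`).
[cite: Balaban1985Variational, Thm 1 (8) p.279 and Prop 7 p.299; Balaban1985UV3, (5) p.256] -/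
theorem regularityLetterRegPr_of_thm1GlobalMinAt {L : ℕ} {a₀ a₁ B₃ : ℝ} (hT : Thm1GlobalMinAt L a₀ a₁ B₃) {F : T3Family} (hF : F.L = L)
    {γ : ℝ} (hγ : 0 < γ) {n K : ℕ} (hnK : n < K) {ε₁ : ℝ} (hε₁ : 0 < ε₁) (hε₁a : ε₁ ≤ a₁) (hB₃ : 0 ≤ B₃) (hhi : B₃ * ε₁ ≤ a₀) :
    ∀ V : GaugeField (F.P n) 0 (Matrix.specialUnitaryGroup (Fin 2) ℂ), PlaqSmall ε₁ V →
      (F.scheme ℰp γ).β K * minActionRegPr F n K hnK.le a₀ V ≤ 12 * (B₃ * ε₁) ^ 2 / γ * (F.L : ℝ) ^ (3 * F.m + 4 * n) := by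
  intro V hV
  obtain ⟨U, hU8, -⟩ := hT F hF n K hnK ε₁ a₀ hε₁ hε₁a hhi le_rfl V hV
  have hU6 : U ∈ regFibrePr F n K hnK.le a₀ V := regFibrePr_mono F hhi V hU8
  have hreg : PlaqSmall (regThreshold F n K (B₃ * ε₁)) U := hU8.1.2
  have hL : (0 : ℝ) < F.L := by have := F.hL.2; exact_mod_cast (by omega : 0 < F.L)
  have hthr : 0 ≤ regThreshold F n K (B₃ * ε₁) := by
    unfold regThreshold; positivity
  have hA := wilsonAction4_le_of_plaqSmall_run F K hthr hreg
  have hβ : 0 ≤ (F.scheme ℰp γ).β K := F.scheme_β_nonneg ℰp hγ.le K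
  have hmin : minActionRegPr F n K hnK.le a₀ V ≤ wilsonAction4 U := minActionRegPr_le F hU6
  calc (F.scheme ℰp γ).β K * minActionRegPr F n K hnK.le a₀ V
      ≤ (F.scheme ℰp γ).β K * (12 * (regThreshold F n K (B₃ * ε₁)) ^ 2 * (F.L : ℝ) ^ (3 * (F.m + K))) :=
        mul_le_mul_of_nonneg_left (hmin.trans hA) hβ
    _ = 12 * (B₃ * ε₁) ^ 2 / γ * (F.L : ℝ) ^ (3 * F.m + 4 * n) := by
        obtain ⟨k, rfl⟩ := Nat.exists_eq_add_of_le hnK.le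
        rw [show (F.scheme ℰp γ).β (n + k) = (γ * ((F.L : ℝ)⁻¹) ^ (n + k))⁻¹ from rfl]
        unfold regThreshold
        rw [show n + k - n = k by omega]
        have hx : (F.L : ℝ) ≠ 0 := hL.ne'
        simp only [inv_pow]
        field_simp
        ring

/-- `minAction ≤ minActionRegPr` always (bigger set, smaller infimum; lit ✓`minAction_le_minActionRegPr` when print's fibre is nonempty, here via the schema's point): so the
`minAction`-currency lower letter of §2–§3 IMPLIES print's `minActionRegPr`-currency letter, never conversely without the global reading.  Recorded as the one-line comparison used below.
[cite: Balaban1985Variational, Thm 1 (8) p.279] -/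
theorem exp_minActionRegPr_le_exp_minAction {F : T3Family} {γ : ℝ} (hγ : 0 ≤ γ) {n K : ℕ} (hK : n ≤ K) {a₀ O : ℝ}
    (V : GaugeField (F.P n) 0 (Matrix.specialUnitaryGroup (Fin 2) ℂ)) (hne : (regFibrePr F n K hK a₀ V).Nonempty) :
    Real.exp (-((F.scheme ℰp γ).β K * minActionRegPr F n K hK a₀ V) - O) ≤
      Real.exp (-((F.scheme ℰp γ).β K * minAction F ℰp n K hK V) - O) := by
  apply Real.exp_le_exp.mpr
  have h := mul_le_mul_of_nonneg_left (minAction_le_minActionRegPr F hne) (F.scheme_β_nonneg ℰp hγ K)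
  linarith

/-- ★★★★ **PERS₁∘ VERBATIM ⟸ PRINT'S TWO THEOREMS WITH PRINT'S OWN QUANTITIES** (the honest «literal» edition): for every odd `L > 1`, [7]'s constants `a₀ a₁ B₃` with `Thm1GlobalMinAt L a₀ a₁ B₃`
AND, in PERS₁∘'s prefix after `F, γ`, a run normalisation `E` with (5) UPPER (lit `Bounds5UpperAtHeight F γ E`) and (5) LOWER in the `minActionRegPr … a₀` currency on print's window
`{PlaqSmall θBal_n(b₀)}`: `exp(−β_K·minActionRegPr_{n,K}(a₀;V) − O1_n·|T₁|) ≤ e^{−E_K}ρ_{K−n}(V)` a.e., `n < K` (at `K = n` the datum is its own fibre: the letter is asked with `minAction`, i.e.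
`e^{−β_nA(V) − O1}`).  Conclusion: PERS₁∘ byte for byte.  Proof: γ₁ cut by lit ✓`exists_forall_θBal_le` to `θBal_n ≤ min a₁ (a₀∕B₃)`, then `regularityLetterRegPr_of_thm1GlobalMinAt` folds the
`n < K` letters, ✓`minAction_self` the diagonal, and ✓`oneLevelPersistenceIntCan_of_bounds5TwoSided_balabanWindow` finishes.  HONEST SCOPE: a door; print's theorems are NOT proved here;
PERS₁∘∕LFR♯ᶜ∘∕S2β∕20520 NOT proved. [cite: Balaban1985UV3, (4)-(7) pp.256-257, Thm 1 p.257; Balaban1985Variational, Thm 1 p.279 and Prop 7 p.299] -/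
theorem oneLevelPersistenceIntCan_of_bounds5LiteralRegPr_thm1
    (h : ∀ (L : ℕ), ∃ a₀ a₁ B₃ : ℝ, (Odd L → 1 < L → 0 < a₀ ∧ 0 < a₁ ∧ 0 < B₃ ∧ Thm1GlobalMinAt L a₀ a₁ B₃) ∧
      ∃ c₀ : ℝ, 0 < c₀ ∧ c₀ ≤ 1 ∧ ∀ (c : ℝ), 0 < c → c ≤ c₀ → ∃ pS : ℝ, ∀ (b₀ p₀ : ℝ), 0 < b₀ → pS ≤ p₀ → 0 < p₀ →
      ∃ γ₁ : ℝ, 0 < γ₁ ∧ ∀ (F : T3Family) (γ : ℝ), F.L = L → 0 < γ → γ ≤ γ₁ →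
        ∃ E : ℕ → ℝ, Bounds5UpperAtHeight F γ E ∧
          ∀ n : ℕ, ∃ O1 : ℝ,
            (∀ᵐ V ∂(fieldMeasure (F.P n) 0 (Matrix.specialUnitaryGroup (Fin 2) ℂ)), PlaqSmall (θBal F.L γ b₀ p₀ n) V →
              Real.exp (-((F.scheme ℰp γ).β n * wilsonAction4 V) - O1 * ((F.P n).sitesPerDir 0 : ℝ) ^ 3) ≤
                Real.exp (-E n) * heightDensity F γ (le_refl n) Set.univ V) ∧
            ∀ (K : ℕ) (hnK : n < K),
              ∀ᵐ V ∂(fieldMeasure (F.P n) 0 (Matrix.specialUnitaryGroup (Fin 2) ℂ)), PlaqSmall (θBal F.L γ b₀ p₀ n) V →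
                Real.exp (-((F.scheme ℰp γ).β K * minActionRegPr F n K hnK.le a₀ V) - O1 * ((F.P n).sitesPerDir 0 : ℝ) ^ 3) ≤
                  Real.exp (-E K) * heightDensity F γ hnK.le Set.univ V) :
    ∀ (L : ℕ), ∃ c₀ : ℝ, 0 < c₀ ∧ c₀ ≤ 1 ∧ ∀ (c : ℝ), 0 < c → c ≤ c₀ → ∃ pS : ℝ, ∀ (b₀ p₀ : ℝ), 0 < b₀ → pS ≤ p₀ → 0 < p₀ →
      ∃ γ₁ : ℝ, 0 < γ₁ ∧ ∀ (F : T3Family) (γ : ℝ), F.L = L → 0 < γ → γ ≤ γ₁ →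
        ∀ (J : ℕ), ∃ q : ℝ, 0 < q ∧ ∀ (K : ℕ) (hJK : J + 1 ≤ K)
          (B : Set (GaugeField (F.P J) 0 (Matrix.specialUnitaryGroup (Fin 2) ℂ))), MeasurableSet B →
            B ⊆ {U | PlaqSmall (θBal F.L γ (c * b₀) p₀ J) U} →
            ENNReal.ofReal q * gibbsK F ℰp γ K (descendTo F ℰp J K ((Nat.le_succ J).trans hJK) ⁻¹' B) ≤
              gibbsK F ℰp γ K (descendTo F ℰp J K ((Nat.le_succ J).trans hJK) ⁻¹' B ∩
                descendTo F ℰp (J + 1) K hJK ⁻¹' {V | PlaqSmall (θBal F.L γ (c * b₀) p₀ (J + 1)) V}) := by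
  refine oneLevelPersistenceIntCan_of_bounds5TwoSided_balabanWindow fun L => ?_
  obtain ⟨a₀, a₁, B₃, hTL, c₀, hc₀, hc₀1, hc⟩ := h L
  refine ⟨c₀, hc₀, hc₀1, fun c hcpos hcle => ?_⟩
  obtain ⟨pS, hpS⟩ := hc c hcpos hcle
  refine ⟨pS, fun b₀ p₀ hb₀ hpS' hp₀ => ?_⟩
  obtain ⟨γ₁, hγ₁, hγ₁F⟩ := hpS b₀ p₀ hb₀ hpS' hp₀
  by_cases hLo : Odd L ∧ 1 < L
  · obtain ⟨ha₀, ha₁, hB₃, hT⟩ := hTL hLo.1 hLo.2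
    have hL1 : 1 ≤ L := le_of_lt hLo.2
    have hσ : 0 < min a₁ (a₀ / B₃) := lt_min ha₁ (div_pos ha₀ hB₃)
    obtain ⟨γθ, hγθ, hθ⟩ := exists_forall_θBal_le hL1 b₀ p₀ hσ
    refine ⟨min γ₁ (min γθ 1), lt_min hγ₁ (lt_min hγθ one_pos), (min_le_right _ _).trans (min_le_right _ _), fun F γ hFL hγ hγle => ?_⟩
    obtain ⟨E, h5, hlit⟩ := hγ₁F F γ hFL hγ (hγle.trans (min_le_left _ _))
    have hγθ' : γ ≤ γθ := (hγle.trans (min_le_right _ _)).trans (min_le_left _ _)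
    have hγ1 : γ ≤ 1 := (hγle.trans (min_le_right _ _)).trans (min_le_right _ _)
    refine ⟨E, h5, fun n => ?_⟩
    obtain ⟨O1, hdiag, hoff⟩ := hlit n
    have hFL1 : 1 ≤ F.L := F.hL.2.le
    have hθ0 : 0 < θBal F.L γ b₀ p₀ n := T3MinimiserStabilityReduction.θBal_pos hFL1 hγ hγ1 hb₀ p₀ n
    have hθle : θBal F.L γ b₀ p₀ n ≤ min a₁ (a₀ / B₃) := by rw [hFL]; exact hθ γ hγ hγθ' n
    have hhi : B₃ * θBal F.L γ b₀ p₀ n ≤ a₀ := by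
      have h' := mul_le_mul_of_nonneg_left (hθle.trans (min_le_right _ _)) hB₃.le
      rwa [mul_div_cancel₀ _ hB₃.ne'] at h'
    set A₀ : ℝ := max (12 * (B₃ * θBal F.L γ b₀ p₀ n) ^ 2 / γ * (F.L : ℝ) ^ (3 * F.m + 4 * n))
      ((F.scheme ℰp γ).β n * (12 * θBal F.L γ b₀ p₀ n ^ 2 * (F.L : ℝ) ^ (3 * (F.m + n)))) with hA₀
    refine ⟨Real.exp (-A₀ - O1 * ((F.P n).sitesPerDir 0 : ℝ) ^ 3), Real.exp_pos _, fun K hK => ?_⟩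
    rcases Nat.lt_or_ge n K with hlt | hge
    · filter_upwards [hoff K hlt] with V hV hVs
      refine le_trans (Real.exp_le_exp.mpr ?_) (hV hVs)
      have := (regularityLetterRegPr_of_thm1GlobalMinAt hT hFL hγ hlt hθ0 (hθle.trans (min_le_left _ _)) hB₃.le hhi V hVs).trans
        (le_max_left _ ((F.scheme ℰp γ).β n * (12 * θBal F.L γ b₀ p₀ n ^ 2 * (F.L : ℝ) ^ (3 * (F.m + n)))))
      linarith
    · obtain rfl : n = K := le_antisymm hK hge
      filter_upwards [hdiag] with V hV hVs
      refine le_trans (Real.exp_le_exp.mpr ?_) (hV hVs)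
      have := (mul_le_mul_of_nonneg_left (wilsonAction4_le_of_plaqSmall_run F n hθ0.le hVs) (F.scheme_β_nonneg ℰp hγ.le n)).trans
        (le_max_right (12 * (B₃ * θBal F.L γ b₀ p₀ n) ^ 2 / γ * (F.L : ℝ) ^ (3 * F.m + 4 * n)) _)
      linarith
  · refine ⟨min γ₁ 1, lt_min hγ₁ one_pos, min_le_right _ _, fun F γ hFL _ _ => ?_⟩
    exact absurd (hFL ▸ F.hL) hLo

end Summit.QuantumFields.YangMills.Theorems.FluctuationComparisonRegPrIntLHeightwisePersistencePrintLiteral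

end
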